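import Summits.AtomisticToContinuum.Crystallization.Theorems.FrustratedLawDichotomyStrainedPatchHomCurvLeafHCC

/-!
# KERNEL SMOKE of the centred-slope ξ-convexity verdict `entryLeafOKHCC` at the hcp⋆ box (`U ∈ 0.9713·1 ± 2⁻⁹`, `ξ ∈ 0 ± 0.005`)

decomp-a2c hand-1 g28 (crux `AperiodicFrustratedLawGap`, stmt-AtomisticToContinuum-27623; `(H) HomFloor (1/625)`, hcp half; lever (C), critic row
1083 (B)).  On the box `(cStar2, wStar2)` of `…HomCurvLeafL2Smoke`:

* `slopeGsCC_star`: the centred slope constant is `20014805268013 = 0.0711·SC` (the naive `slopeGs` of `…HomCurvLeafHC` on the same reference box is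
  `923620745810198 = 3.28·SC`, hand-1 g27 KernelHC2): the ξ-elimination loss `Gs²/(2·lamS)` drops from `0.87` to `4.1e-4` energy units;
* ★★ `entryLeafOKHCC_star`: the verdict FIRES (`= true`) at `μ = 2(m + e_W)·SC`, `m = −0.0025` (hcp⋆ surplus `−0.00124`; the naive-slope verdict
  `entryLeafOKHC` is `false` there even at `m = −0.003`, hand-1 g27 FINDING 04:14Z) — value table leaf K1 on the reference box at the shifted target,
  in-kernel `curvLamS`, centred slope, all inside ONE `decide +kernel` (seat farm check: 4 such theorems in 259 s).

Kernel facts only (`decide +kernel`, no `native_decide`); 0 sorry; standard axioms.  `--supports stmt-AtomisticToContinuum-27623`.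
-/

namespace Summit.AtomisticToContinuum.Crystallization.Theorems.FrustratedLawDichotomyStrainedPatchHomCurvLeafHCC

open Literature.Analysis.ValidatedNumerics.Numerics
open Summit.AtomisticToContinuum.Crystallization.Theorems.FrustratedLawDichotomyStrainedPatchHomCurvLeafL2 (cStar2 wStar2)

/-- `μ = 2(m + e_W)·SC` for `m` in micro-units (`e_W = −0.7175 + 3/400`), rounded down. -/
def muMicro (mMicro : ℤ) : ℤ := 2 * (mMicro * 281474976710656 / 1000000 + ((-7175 + 75) * 281474976710656 / 10000))

/-- ★ KERNEL: the centred slope constant at the hcp⋆ reference box is `0.0711·SC`. -/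
theorem slopeGsCC_star : slopeGsCC cStar2 wStar2 = 20014805268013 := by decide +kernel

/-- ★★ KERNEL MustPass: the centred-slope ξ-convexity verdict fires at hcp⋆ (`U 2⁻⁹ × ξ 0.005`) at `m = −0.0025`. -/
theorem entryLeafOKHCC_star : entryLeafOKHCC (muMicro (-2500)) cStar2 wStar2 = true := by decide +kernel

end Summit.AtomisticToContinuum.Crystallization.Theorems.FrustratedLawDichotomyStrainedPatchHomCurvLeafHCC
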